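import Literature.NumberTheory.Automorphic.UnitaryGroupTorusCentreLatticeIntegrand
import Literature.NumberTheory.Automorphic.UnitaryGroupHeisenbergLatticeCollapse
import Literature.NumberTheory.Automorphic.UnitaryGroupIwasawaIntegration
import Literature.NumberTheory.Automorphic.IdelicDyadicUnfolding
import Mathlib.MeasureTheory.Integral.Bochner.Set
import HarnessLib

/-!
# The `K`-average of the centre-lattice sum of the unipotent term of `U(J₃)` as a lattice sum over `F^*` of
# the norm profile (Rogawski, *Automorphic Representations of Unitary Groups in Three Variables* (1990), §7.3,
# proof of Prop. 7.3.2, (7.3.2)–(7.3.3), pp. 96–97; §2.2 p. 13 «the sums are finite»)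

Topic `NumberTheory/Automorphic`; namespace `Literature.NumberTheory.Automorphic.UnitaryGroup`. THEOREMS ONLY over
accepted tree modules (no definition, no named fact, no instance, no notation, no `sorry`). Row (C-K) FILE 2 — the
ANALYTIC HALF of «TORUS INTEGRAND OF THE CENTRE LATTICE SUM» (sequel of ★ `UnitaryGroupTorusCentreLatticeIntegrand`;
piece (C) of the unipotent term on the LAW 5 road of `Cruxes/H413/Lines/F0_T1InnerFormTraceIdentity.lean`, crux H413;
cell hodgecm-mathlib). Letters as there: `ζ`, `z₁` (`↑z₁ = toAdelic (z · 1)`), `n(y) = heisChart hc (0, y)`, the centre lattice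
sum `ψᶜ_f(g) = Σ'_{w ∈ E⁻ ∖ 0} f(g⁻¹ (z₁ n(w)) g)` spelled inline, the line `θ = traceZeroLine F E c hcδ hδ`, the relative
norm `N = AdeleRing.ideleRelNorm F E`, `d₀ t = diagUnit (↑t).2 0`; and `K = K_U = adelicVal⁻¹(K_∞ · GL₃(𝒪̂_E))` with a
Haar measure `μK` (verbatim as ★ (G-b) `exists_weight_iwasawa_kAverage_three` ∕ ★ (C-G)).

* §1 `measurable_tsum_centre`; UNIFORM FINITENESS `finite_setOf_centre_exists_conj_mem_of_isCompact` ∕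
  `exists_finset_forall_conj_centre_eq_zero`: on a compact set of conjugators only finitely many `w ∈ E⁻ ∖ 0` bring
  `z₁ n(w)` into a compact set (★ `finite_setOf_exists_inv_mul_mul_mem_of_isCompact`: `z₁ n(w) ∈ G(F)`, `G(F)` discrete).
* §2 **`integral_tsum_centre_mul_eq_tsum_integral`**: for `f ∈ C_c(G(𝔸_F))`, `∫_K` and `Σ'_{w ≠ 0}` commute along `y K`
  (both sides one finite sum).
* §3 **`integral_tsum_centre_torus_mul_eq_tsum_principalIdeles`**: for `E/F` quadratic,
  `∫_K ψᶜ_f(t k) dμK = Σ'_{k ∈ F^*} Φ(k · N(d₀ t))` for every `Φ` agreeing with the NORM PROFILE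
  `y ↦ ∫_K f(k⁻¹ (z₁ n(θ(y⁻¹))) k) dμK` (★ FILE 1 `tsum_centre_conj_torus_mul_eq_tsum_principalIdeles` at `g = 1`); the
  `[0, ∞]` twin with `≤` and no support hypothesis `lintegral_enorm_tsum_centre_torus_mul_le`; continuity ∕ measurability
  of the profile `continuous_centreProfile` ∕ `measurable_centreProfile` (Mathlib `continuous_parametric_integral_of_continuous`).
  With ★ (C-G) and ★ (C-P) these are the inputs of the (C-γ) assembly `(hCi, hCv, hCfin)`.

HC_CM is proved only modulo the 7 printed citations until rung 0 closes — nothing here bears on a summit statement.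

## References
* J. D. Rogawski, *Automorphic Representations of Unitary Groups in Three Variables*, Ann. of Math. Stud. 123 (1990),
  §2.2 (p. 13), §7.3 Prop. 7.3.2, (7.3.2)–(7.3.3) (pp. 96–97) [Rogawski1990].
* S. Gelbart, *Automorphic Forms on Adele Groups*, Ann. of Math. Stud. 83 (1975), (9.20) [Gelbart1975].
-/

set_option autoImplicit false

noncomputable section

open MeasureTheory Measure NumberField IsDedekindDomain Topology Set
open scoped MatrixGroups NNReal ENNReal

namespace Literature.NumberTheory.Automorphic

namespace UnitaryGroup

variable {F E : Type} [Field F] [NumberField F] [Field E] [NumberField E] [Algebra F E]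
  {c : E ≃ₐ[F] E}

variable (ζ : ratOne F E c) {z₁ : (quasiSplit F E c 3).arithmeticSubgroup}

section Plumbing

omit [NumberField F] in
/-- `E⁻ ∖ 0` is countable (★ `countable_rationalTraceZero`). [folklore] -/
private theorem countable_rationalTraceZero_ne_zero : Countable {w : rationalTraceZero F E c // w ≠ 0} := by
  haveI : Countable (rationalTraceZero F E c) := countable_rationalTraceZero
  exact Subtype.countable


/-- Conjugation by `t k` versus conjugation by `t · 1` followed by `k` (group plumbing). [folklore] -/
private theorem conj_torus_mul_eq (T X k : (quasiSplit F E c 3).Adelic) :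
    (T * k)⁻¹ * X * (T * k) = k⁻¹ * ((T * 1)⁻¹ * X * (T * 1)) * k := by group

/-- `1⁻¹ X 1 = X` (group plumbing). [folklore] -/
private theorem one_inv_mul_mul_one (X : (quasiSplit F E c 3).Adelic) : (1 : (quasiSplit F E c 3).Adelic)⁻¹ * X * 1 = X := by group

/-- `K_U` is a compact space (★ `isCompact_comap_adelicVal_standardMaximalCompactGL`). [folklore] -/
private theorem compactSpace_KU : CompactSpace ((standardMaximalCompactGL 3 E).comap
    (adelicVal F E c 3 ((StdForm.antidiagonal 3).over E)) : Subgroup (quasiSplit F E c 3).Adelic) :=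
  isCompact_iff_compactSpace.1 isCompact_comap_adelicVal_standardMaximalCompactGL

end Plumbing

/-! ## §1 Measurability; uniform finiteness of the contributing lattice points -/

section Finite

/-- **Only finitely many lattice points contribute on a compact set of conjugators**: for compact `C, K ⊆ G(𝔸_F)`, the
set of `w ∈ E⁻ ∖ 0` with `y⁻¹ (z₁ n(w)) y ∈ K` for some `y ∈ C` is finite (`z₁ n(w) ∈ G(F)`, ★
`finite_setOf_exists_inv_mul_mul_mem_of_isCompact`, and `w ↦ z₁ n(w)` is injective). Rogawski (1990), §2.2 p. 13 «the sums
are finite». [cite: Rogawski1990, §2.2 (p. 13)] [cite: Gelbart1975, (9.20)] -/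
theorem finite_setOf_centre_exists_conj_mem_of_isCompact (hc : c * c = 1) (z₁ : (quasiSplit F E c 3).arithmeticSubgroup)
    {C K : Set (quasiSplit F E c 3).Adelic} (hC : IsCompact C) (hK : IsCompact K) :
    {w : {w : rationalTraceZero F E c // w ≠ 0} | ∃ y ∈ C,
      y⁻¹ * ((z₁ : (quasiSplit F E c 3).Adelic) *
        ((heisChart hc ((0 : AdeleRing (𝓞 E) E), ((w.1 : rationalTraceZero F E c) : traceZeroAdele F E c)) :
          adelicUnipotent F E c 3) : (quasiSplit F E c 3).Adelic)) * y ∈ K}.Finite := by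
  have hfin := finite_setOf_exists_inv_mul_mul_mem_of_isCompact (F := F) (E := E) (c := c) (N := 3) hC hK
  -- the injection `w ↦ z₁ · n(w) ∈ G(F)`
  let ι : {w : rationalTraceZero F E c // w ≠ 0} → (quasiSplit F E c 3).arithmeticSubgroup := fun w =>
    z₁ * ⟨((heisChart hc ((0 : AdeleRing (𝓞 E) E), ((w.1 : rationalTraceZero F E c) : traceZeroAdele F E c)) :
        adelicUnipotent F E c 3) : (quasiSplit F E c 3).Adelic), (heisChart_zero_coe_mem_rationalUnipotent hc w.1 :)⟩
  have hι : ∀ w, ((ι w : (quasiSplit F E c 3).arithmeticSubgroup) : (quasiSplit F E c 3).Adelic) =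
      (z₁ : (quasiSplit F E c 3).Adelic) *
        ((heisChart hc ((0 : AdeleRing (𝓞 E) E), ((w.1 : rationalTraceZero F E c) : traceZeroAdele F E c)) :
          adelicUnipotent F E c 3) : (quasiSplit F E c 3).Adelic) := fun w => rfl
  have hinj : Set.InjOn ι (ι ⁻¹' {γ : (quasiSplit F E c 3).arithmeticSubgroup |
      ∃ y ∈ C, y⁻¹ * (γ : (quasiSplit F E c 3).Adelic) * y ∈ K}) := by
    intro w _ w' _ h
    have h' := congrArg (fun γ : (quasiSplit F E c 3).arithmeticSubgroup => (γ : (quasiSplit F E c 3).Adelic)) h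
    simp only [hι] at h'
    have h'' := Subtype.val_injective (mul_left_cancel h')
    exact Subtype.ext (Subtype.ext (heisChart_pair_injective hc h'').2)
  refine (hfin.preimage hinj).subset fun w hw => ?_
  obtain ⟨y, hy, hyK⟩ := hw
  exact ⟨y, hy, by rw [hι]; exact hyK⟩

/-- **Finitely many `w` on a compact**: for `φ` of compact support and compact `C ⊆ G(𝔸_F)` there is a finite `S ⊆ E⁻ ∖ 0` off
which `φ(y⁻¹ (z₁ n(w)) y) = 0` for all `y ∈ C`. [cite: Rogawski1990, §2.2 (p. 13)] -/
theorem exists_finset_forall_conj_centre_eq_zero {V : Type*} [Zero V] [TopologicalSpace V] (hc : c * c = 1)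
    (z₁ : (quasiSplit F E c 3).arithmeticSubgroup)
    {φ : (quasiSplit F E c 3).Adelic → V} (hφ : HasCompactSupport φ) {C : Set (quasiSplit F E c 3).Adelic} (hC : IsCompact C) :
    ∃ S : Finset {w : rationalTraceZero F E c // w ≠ 0}, ∀ y ∈ C, ∀ w : {w : rationalTraceZero F E c // w ≠ 0}, w ∉ S →
      φ (y⁻¹ * ((z₁ : (quasiSplit F E c 3).Adelic) *
        ((heisChart hc ((0 : AdeleRing (𝓞 E) E), ((w.1 : rationalTraceZero F E c) : traceZeroAdele F E c)) :
          adelicUnipotent F E c 3) : (quasiSplit F E c 3).Adelic)) * y) = 0 := by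
  classical
  have hfin := finite_setOf_centre_exists_conj_mem_of_isCompact (F := F) (E := E) (c := c) hc z₁ hC hφ.isCompact
  refine ⟨hfin.toFinset, fun y hy w hw => ?_⟩
  by_contra hne
  exact hw (hfin.mem_toFinset.2 ⟨y, hy, subset_tsupport _ hne⟩)

variable [MeasurableSpace (quasiSplit F E c 3).Adelic] [BorelSpace (quasiSplit F E c 3).Adelic]

/-- **Measurability of the centre lattice sum** `g ↦ Σ'_{w ≠ 0} f(g⁻¹ (z₁ n(w)) g)` for continuous `f` (countable sum of
continuous functions). [cite: Rogawski1990, §7.3 Prop. 7.3.2 (p. 96)] -/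
theorem measurable_tsum_centre (hc : c * c = 1) (z₁ : (quasiSplit F E c 3).arithmeticSubgroup)
    {f : (quasiSplit F E c 3).Adelic → ℂ} (hf : Continuous f) :
    Measurable fun g : (quasiSplit F E c 3).Adelic => ∑' w : {w : rationalTraceZero F E c // w ≠ 0},
      f (g⁻¹ * ((z₁ : (quasiSplit F E c 3).Adelic) *
        ((heisChart hc ((0 : AdeleRing (𝓞 E) E), ((w.1 : rationalTraceZero F E c) : traceZeroAdele F E c)) :
          adelicUnipotent F E c 3) : (quasiSplit F E c 3).Adelic)) * g) := by
  haveI := countable_rationalTraceZero_ne_zero (F := F) (E := E) (c := c)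
  refine Measurable.tsum fun w => ?_
  exact (hf.comp ((continuous_id.inv.mul continuous_const).mul continuous_id)).measurable

end Finite

/-! ## §2 `∫_K` and `Σ'_{w ≠ 0}` commute -/

section KAverage

variable [MeasurableSpace (quasiSplit F E c 3).Adelic] [BorelSpace (quasiSplit F E c 3).Adelic]

variable (μK : Measure ((standardMaximalCompactGL 3 E).comap
    (adelicVal F E c 3 ((StdForm.antidiagonal 3).over E)) : Subgroup (quasiSplit F E c 3).Adelic)) [μK.IsHaarMeasure]

/-- **`∫_K` AND `Σ'_{w ≠ 0}` COMMUTE** for `f ∈ C_c(G(𝔸_F))`: at every `y ∈ G(𝔸_F)`,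
`∫_K Σ'_{w ≠ 0} f((y k)⁻¹ (z₁ n(w)) (y k)) dμK = Σ'_{w ≠ 0} ∫_K f((y k)⁻¹ (z₁ n(w)) (y k)) dμK` — on the compact `y K` only
finitely many `w` contribute (both sides are the same FINITE sum). [cite: Rogawski1990, §2.2 (p. 13)] [cite: Rogawski1990, §7.3 (7.3.2)] -/
theorem integral_tsum_centre_mul_eq_tsum_integral (hc : c * c = 1) (z₁ : (quasiSplit F E c 3).arithmeticSubgroup)
    {f : (quasiSplit F E c 3).Adelic → ℂ} (hfc : HasCompactSupport f) (hf : Continuous f) (y : (quasiSplit F E c 3).Adelic) :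
    ∫ k, (∑' w : {w : rationalTraceZero F E c // w ≠ 0},
      f ((y * (k : (quasiSplit F E c 3).Adelic))⁻¹ * ((z₁ : (quasiSplit F E c 3).Adelic) *
        ((heisChart hc ((0 : AdeleRing (𝓞 E) E), ((w.1 : rationalTraceZero F E c) : traceZeroAdele F E c)) :
          adelicUnipotent F E c 3) : (quasiSplit F E c 3).Adelic)) * (y * (k : (quasiSplit F E c 3).Adelic)))) ∂μK =
      ∑' w : {w : rationalTraceZero F E c // w ≠ 0}, ∫ k,
        f ((y * (k : (quasiSplit F E c 3).Adelic))⁻¹ * ((z₁ : (quasiSplit F E c 3).Adelic) *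
          ((heisChart hc ((0 : AdeleRing (𝓞 E) E), ((w.1 : rationalTraceZero F E c) : traceZeroAdele F E c)) :
            adelicUnipotent F E c 3) : (quasiSplit F E c 3).Adelic)) * (y * (k : (quasiSplit F E c 3).Adelic))) ∂μK := by
  haveI := compactSpace_KU (F := F) (E := E) (c := c)
  haveI : IsFiniteMeasure μK := CompactSpace.isFiniteMeasure
  -- the compact set of conjugators `y K`
  have hC : IsCompact ((fun k : ((standardMaximalCompactGL 3 E).comap
      (adelicVal F E c 3 ((StdForm.antidiagonal 3).over E)) : Subgroup (quasiSplit F E c 3).Adelic) =>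
        y * (k : (quasiSplit F E c 3).Adelic)) '' Set.univ) :=
    isCompact_univ.image (continuous_const.mul continuous_subtype_val)
  obtain ⟨S, hS⟩ := exists_finset_forall_conj_centre_eq_zero (F := F) (E := E) (c := c) hc z₁ hfc hC
  have hzero : ∀ (k : ((standardMaximalCompactGL 3 E).comap
      (adelicVal F E c 3 ((StdForm.antidiagonal 3).over E)) : Subgroup (quasiSplit F E c 3).Adelic))
      (w : {w : rationalTraceZero F E c // w ≠ 0}), w ∉ S →
      f ((y * (k : (quasiSplit F E c 3).Adelic))⁻¹ * ((z₁ : (quasiSplit F E c 3).Adelic) *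
        ((heisChart hc ((0 : AdeleRing (𝓞 E) E), ((w.1 : rationalTraceZero F E c) : traceZeroAdele F E c)) :
          adelicUnipotent F E c 3) : (quasiSplit F E c 3).Adelic)) * (y * (k : (quasiSplit F E c 3).Adelic))) = 0 :=
    fun k w hw => hS _ ⟨k, Set.mem_univ _, rfl⟩ w hw
  -- each term is integrable on the compact group `K`
  have hint : ∀ w : {w : rationalTraceZero F E c // w ≠ 0}, Integrable (fun k : ((standardMaximalCompactGL 3 E).comap
      (adelicVal F E c 3 ((StdForm.antidiagonal 3).over E)) : Subgroup (quasiSplit F E c 3).Adelic) =>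
      f ((y * (k : (quasiSplit F E c 3).Adelic))⁻¹ * ((z₁ : (quasiSplit F E c 3).Adelic) *
        ((heisChart hc ((0 : AdeleRing (𝓞 E) E), ((w.1 : rationalTraceZero F E c) : traceZeroAdele F E c)) :
          adelicUnipotent F E c 3) : (quasiSplit F E c 3).Adelic)) * (y * (k : (quasiSplit F E c 3).Adelic)))) μK := by
    intro w
    have hcont : Continuous fun k : ((standardMaximalCompactGL 3 E).comap
        (adelicVal F E c 3 ((StdForm.antidiagonal 3).over E)) : Subgroup (quasiSplit F E c 3).Adelic) =>
        f ((y * (k : (quasiSplit F E c 3).Adelic))⁻¹ * ((z₁ : (quasiSplit F E c 3).Adelic) *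
          ((heisChart hc ((0 : AdeleRing (𝓞 E) E), ((w.1 : rationalTraceZero F E c) : traceZeroAdele F E c)) :
            adelicUnipotent F E c 3) : (quasiSplit F E c 3).Adelic)) * (y * (k : (quasiSplit F E c 3).Adelic))) :=
      hf.comp (((continuous_const.mul continuous_subtype_val).inv.mul continuous_const).mul
        (continuous_const.mul continuous_subtype_val))
    exact hcont.integrable_of_hasCompactSupport
      (IsCompact.of_isClosed_subset isCompact_univ (isClosed_tsupport _) (Set.subset_univ _))
  have hL : ∀ k : ((standardMaximalCompactGL 3 E).comap
      (adelicVal F E c 3 ((StdForm.antidiagonal 3).over E)) : Subgroup (quasiSplit F E c 3).Adelic),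
      (∑' w : {w : rationalTraceZero F E c // w ≠ 0},
        f ((y * (k : (quasiSplit F E c 3).Adelic))⁻¹ * ((z₁ : (quasiSplit F E c 3).Adelic) *
          ((heisChart hc ((0 : AdeleRing (𝓞 E) E), ((w.1 : rationalTraceZero F E c) : traceZeroAdele F E c)) :
            adelicUnipotent F E c 3) : (quasiSplit F E c 3).Adelic)) * (y * (k : (quasiSplit F E c 3).Adelic)))) =
      ∑ w ∈ S, f ((y * (k : (quasiSplit F E c 3).Adelic))⁻¹ * ((z₁ : (quasiSplit F E c 3).Adelic) *
          ((heisChart hc ((0 : AdeleRing (𝓞 E) E), ((w.1 : rationalTraceZero F E c) : traceZeroAdele F E c)) :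
            adelicUnipotent F E c 3) : (quasiSplit F E c 3).Adelic)) * (y * (k : (quasiSplit F E c 3).Adelic))) :=
    fun k => tsum_eq_sum fun w hw => hzero k w hw
  simp_rw [hL]
  rw [integral_finsetSum _ fun w _ => hint w, tsum_eq_sum (s := S)]
  intro w hw
  simp only [hzero _ w hw, integral_zero]

/-! ## §3 The `K`-average as a lattice sum over `F^*` of the norm profile -/

variable [Algebra.IsQuadraticExtension F E] {δ : E}

/-- **THE `K`-AVERAGE OF THE CENTRE LATTICE SUM ALONG THE TORUS IS A LATTICE SUM OVER `F^*` OF THE NORM PROFILE**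
[Rogawski1990, (7.3.2)–(7.3.3): after `g = n m k` and the `K`-average `f_K`, the centre term is
`∫_{ZM∖M} Σ_{t ∈ F^*} Φ(t · α₃(m)⁻¹)`, `α₃(m)⁻¹ = N(a)⁻¹`]: for `E/F` quadratic (`c δ = -δ ≠ 0`), `f ∈ C_c(G(𝔸_F))`,
`t ∈ T(𝔸_F)` and every `Φ` agreeing with the NORM PROFILE `y ↦ ∫_K f(k⁻¹ (z₁ n(θ(y⁻¹))) k) dμK`,

  `∫_K Σ'_{w ∈ E⁻, w ≠ 0} f((t k)⁻¹ (z₁ n(w)) (t k)) dμK(k) = Σ'_{k ∈ F^*} Φ(k · N(d₀ t))`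

(★ `integral_tsum_centre_mul_eq_tsum_integral` + ★ `tsum_centre_conj_torus_mul_eq_tsum_principalIdeles`). The right side is the
integrand ★ (C-P) `exists_push_and_integral_tsum_comp_ideleRelNorm_diagUnitZero_eq` pushes to `C ∫_H Φ`.
[cite: Rogawski1990, §7.3 (7.3.2)–(7.3.3) (pp. 96–97)] -/
theorem integral_tsum_centre_torus_mul_eq_tsum_principalIdeles (hc : c * c = 1) (hcδ : c δ = -δ) (hδ : δ ≠ 0)
    (hz₁ : (z₁ : (quasiSplit F E c 3).Adelic) =
      (quasiSplit F E c 3).toAdelic (ratCenter F E c 3 ((StdForm.antidiagonal 3).over E) ζ))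
    {f : (quasiSplit F E c 3).Adelic → ℂ} (hfc : HasCompactSupport f) (hf : Continuous f) (t : torusInBorel F E c 3)
    (Φ : (AdeleRing (𝓞 F) F)ˣ → ℂ)
    (hΦ : ∀ y : (AdeleRing (𝓞 F) F)ˣ, Φ y = ∫ k, f ((k : (quasiSplit F E c 3).Adelic)⁻¹ *
      ((z₁ : (quasiSplit F E c 3).Adelic) *
        ((heisChart hc ((0 : AdeleRing (𝓞 E) E),
            traceZeroLine F E c hcδ hδ (((y⁻¹ : (AdeleRing (𝓞 F) F)ˣ)) : AdeleRing (𝓞 F) F)) :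
          adelicUnipotent F E c 3) : (quasiSplit F E c 3).Adelic)) * (k : (quasiSplit F E c 3).Adelic)) ∂μK) :
    ∫ k, (∑' w : {w : rationalTraceZero F E c // w ≠ 0},
      f (((((t : borelAdelic F E c 3) : (quasiSplit F E c 3).Adelic)) * (k : (quasiSplit F E c 3).Adelic))⁻¹ *
        ((z₁ : (quasiSplit F E c 3).Adelic) *
          ((heisChart hc ((0 : AdeleRing (𝓞 E) E), ((w.1 : rationalTraceZero F E c) : traceZeroAdele F E c)) :
            adelicUnipotent F E c 3) : (quasiSplit F E c 3).Adelic)) *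
        ((((t : borelAdelic F E c 3) : (quasiSplit F E c 3).Adelic)) * (k : (quasiSplit F E c 3).Adelic)))) ∂μK =
      ∑' k : GaloisRepresentations.principalIdeles F,
        Φ (k • AdeleRing.ideleRelNorm F E (diagUnit (t : borelAdelic F E c 3).2 0)) := by
  rw [integral_tsum_centre_mul_eq_tsum_integral μK hc z₁ hfc hf]
  -- the `K`-average as a function of the conjugated point
  set G : (quasiSplit F E c 3).Adelic → ℂ := fun X =>
    ∫ k, f ((k : (quasiSplit F E c 3).Adelic)⁻¹ * X * (k : (quasiSplit F E c 3).Adelic)) ∂μK with hG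
  have key := tsum_centre_conj_torus_mul_eq_tsum_principalIdeles ζ hc hcδ hδ hz₁ G t 1
  calc (∑' w : {w : rationalTraceZero F E c // w ≠ 0}, ∫ k,
        f (((((t : borelAdelic F E c 3) : (quasiSplit F E c 3).Adelic)) * (k : (quasiSplit F E c 3).Adelic))⁻¹ *
          ((z₁ : (quasiSplit F E c 3).Adelic) *
            ((heisChart hc ((0 : AdeleRing (𝓞 E) E), ((w.1 : rationalTraceZero F E c) : traceZeroAdele F E c)) :
              adelicUnipotent F E c 3) : (quasiSplit F E c 3).Adelic)) *
          ((((t : borelAdelic F E c 3) : (quasiSplit F E c 3).Adelic)) * (k : (quasiSplit F E c 3).Adelic))) ∂μK)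
      = ∑' w : {w : rationalTraceZero F E c // w ≠ 0},
          G (((((t : borelAdelic F E c 3) : (quasiSplit F E c 3).Adelic)) * 1)⁻¹ *
            ((z₁ : (quasiSplit F E c 3).Adelic) *
              ((heisChart hc ((0 : AdeleRing (𝓞 E) E), ((w.1 : rationalTraceZero F E c) : traceZeroAdele F E c)) :
                adelicUnipotent F E c 3) : (quasiSplit F E c 3).Adelic)) *
            ((((t : borelAdelic F E c 3) : (quasiSplit F E c 3).Adelic)) * 1)) := by
        refine tsum_congr fun w => ?_
        simp only [hG]
        exact integral_congr_ae (ae_of_all _ fun k => congrArg f (conj_torus_mul_eq _ _ _))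
    _ = _ := key
    _ = ∑' k : GaloisRepresentations.principalIdeles F,
          Φ (k • AdeleRing.ideleRelNorm F E (diagUnit (t : borelAdelic F E c 3).2 0)) := by
        refine tsum_congr fun k => ?_
        rw [hΦ, hG]
        simp only
        exact integral_congr_ae (ae_of_all _ fun k => congrArg f (by rw [one_inv_mul_mul_one]))

omit [μK.IsHaarMeasure] in
/-- **THE `[0, ∞]` TWIN (no support hypothesis, `≤`)**: for continuous `f`, `t ∈ T(𝔸_F)` and every `Φ'` agreeing with
`y ↦ ∫⁻_K ‖f(k⁻¹ (z₁ n(θ(y⁻¹))) k)‖ dμK`,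
`∫⁻_K ‖Σ'_{w ≠ 0} f((t k)⁻¹ (z₁ n(w)) (t k))‖ dμK ≤ Σ'_{k ∈ F^*} Φ'(k · N(d₀ t))`
(`‖Σ'‖ ≤ Σ'‖·‖`, Tonelli `lintegral_tsum`, ★ `tsum_centre_conj_torus_mul_eq_tsum_principalIdeles`) — with ★ (C-G) (L) and ★ (C-P)
§3 (i) this is the finiteness `∫⁻ β ‖ψᶜ‖ < ∞` of the centre term. [cite: Rogawski1990, §7.3 Prop. 7.3.2 (p. 96)] -/
theorem lintegral_enorm_tsum_centre_torus_mul_le (hc : c * c = 1) (hcδ : c δ = -δ) (hδ : δ ≠ 0)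
    (hz₁ : (z₁ : (quasiSplit F E c 3).Adelic) =
      (quasiSplit F E c 3).toAdelic (ratCenter F E c 3 ((StdForm.antidiagonal 3).over E) ζ))
    {f : (quasiSplit F E c 3).Adelic → ℂ} (hf : Continuous f) (t : torusInBorel F E c 3)
    (Φ' : (AdeleRing (𝓞 F) F)ˣ → ℝ≥0∞)
    (hΦ' : ∀ y : (AdeleRing (𝓞 F) F)ˣ, Φ' y = ∫⁻ k, ‖f ((k : (quasiSplit F E c 3).Adelic)⁻¹ *
      ((z₁ : (quasiSplit F E c 3).Adelic) *
        ((heisChart hc ((0 : AdeleRing (𝓞 E) E),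
            traceZeroLine F E c hcδ hδ (((y⁻¹ : (AdeleRing (𝓞 F) F)ˣ)) : AdeleRing (𝓞 F) F)) :
          adelicUnipotent F E c 3) : (quasiSplit F E c 3).Adelic)) * (k : (quasiSplit F E c 3).Adelic))‖ₑ ∂μK) :
    ∫⁻ k, ‖∑' w : {w : rationalTraceZero F E c // w ≠ 0},
      f (((((t : borelAdelic F E c 3) : (quasiSplit F E c 3).Adelic)) * (k : (quasiSplit F E c 3).Adelic))⁻¹ *
        ((z₁ : (quasiSplit F E c 3).Adelic) *
          ((heisChart hc ((0 : AdeleRing (𝓞 E) E), ((w.1 : rationalTraceZero F E c) : traceZeroAdele F E c)) :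
            adelicUnipotent F E c 3) : (quasiSplit F E c 3).Adelic)) *
        ((((t : borelAdelic F E c 3) : (quasiSplit F E c 3).Adelic)) * (k : (quasiSplit F E c 3).Adelic)))‖ₑ ∂μK ≤
      ∑' k : GaloisRepresentations.principalIdeles F,
        Φ' (k • AdeleRing.ideleRelNorm F E (diagUnit (t : borelAdelic F E c 3).2 0)) := by
  haveI := countable_rationalTraceZero_ne_zero (F := F) (E := E) (c := c)
  set G : (quasiSplit F E c 3).Adelic → ℝ≥0∞ := fun X =>
    ∫⁻ k, ‖f ((k : (quasiSplit F E c 3).Adelic)⁻¹ * X * (k : (quasiSplit F E c 3).Adelic))‖ₑ ∂μK with hG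
  have key := tsum_centre_conj_torus_mul_eq_tsum_principalIdeles ζ hc hcδ hδ hz₁ G t 1
  have hmeas : ∀ w : {w : rationalTraceZero F E c // w ≠ 0}, Measurable fun k : ((standardMaximalCompactGL 3 E).comap
      (adelicVal F E c 3 ((StdForm.antidiagonal 3).over E)) : Subgroup (quasiSplit F E c 3).Adelic) =>
      ‖f (((((t : borelAdelic F E c 3) : (quasiSplit F E c 3).Adelic)) * (k : (quasiSplit F E c 3).Adelic))⁻¹ *
        ((z₁ : (quasiSplit F E c 3).Adelic) *
          ((heisChart hc ((0 : AdeleRing (𝓞 E) E), ((w.1 : rationalTraceZero F E c) : traceZeroAdele F E c)) :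
            adelicUnipotent F E c 3) : (quasiSplit F E c 3).Adelic)) *
        ((((t : borelAdelic F E c 3) : (quasiSplit F E c 3).Adelic)) * (k : (quasiSplit F E c 3).Adelic)))‖ₑ :=
    fun w => (hf.comp (((continuous_const.mul continuous_subtype_val).inv.mul continuous_const).mul
      (continuous_const.mul continuous_subtype_val))).measurable.enorm
  calc ∫⁻ k, ‖∑' w : {w : rationalTraceZero F E c // w ≠ 0},
        f (((((t : borelAdelic F E c 3) : (quasiSplit F E c 3).Adelic)) * (k : (quasiSplit F E c 3).Adelic))⁻¹ *
          ((z₁ : (quasiSplit F E c 3).Adelic) *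
            ((heisChart hc ((0 : AdeleRing (𝓞 E) E), ((w.1 : rationalTraceZero F E c) : traceZeroAdele F E c)) :
              adelicUnipotent F E c 3) : (quasiSplit F E c 3).Adelic)) *
          ((((t : borelAdelic F E c 3) : (quasiSplit F E c 3).Adelic)) * (k : (quasiSplit F E c 3).Adelic)))‖ₑ ∂μK
      ≤ ∫⁻ k, ∑' w : {w : rationalTraceZero F E c // w ≠ 0},
          ‖f (((((t : borelAdelic F E c 3) : (quasiSplit F E c 3).Adelic)) * (k : (quasiSplit F E c 3).Adelic))⁻¹ *
            ((z₁ : (quasiSplit F E c 3).Adelic) *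
              ((heisChart hc ((0 : AdeleRing (𝓞 E) E), ((w.1 : rationalTraceZero F E c) : traceZeroAdele F E c)) :
                adelicUnipotent F E c 3) : (quasiSplit F E c 3).Adelic)) *
            ((((t : borelAdelic F E c 3) : (quasiSplit F E c 3).Adelic)) * (k : (quasiSplit F E c 3).Adelic)))‖ₑ ∂μK :=
        lintegral_mono fun k => enorm_tsum_le_tsum_enorm
    _ = ∑' w : {w : rationalTraceZero F E c // w ≠ 0}, ∫⁻ k,
          ‖f (((((t : borelAdelic F E c 3) : (quasiSplit F E c 3).Adelic)) * (k : (quasiSplit F E c 3).Adelic))⁻¹ *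
            ((z₁ : (quasiSplit F E c 3).Adelic) *
              ((heisChart hc ((0 : AdeleRing (𝓞 E) E), ((w.1 : rationalTraceZero F E c) : traceZeroAdele F E c)) :
                adelicUnipotent F E c 3) : (quasiSplit F E c 3).Adelic)) *
            ((((t : borelAdelic F E c 3) : (quasiSplit F E c 3).Adelic)) * (k : (quasiSplit F E c 3).Adelic)))‖ₑ ∂μK :=
        lintegral_tsum fun w => (hmeas w).aemeasurable
    _ = ∑' w : {w : rationalTraceZero F E c // w ≠ 0},
          G (((((t : borelAdelic F E c 3) : (quasiSplit F E c 3).Adelic)) * 1)⁻¹ *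
            ((z₁ : (quasiSplit F E c 3).Adelic) *
              ((heisChart hc ((0 : AdeleRing (𝓞 E) E), ((w.1 : rationalTraceZero F E c) : traceZeroAdele F E c)) :
                adelicUnipotent F E c 3) : (quasiSplit F E c 3).Adelic)) *
            ((((t : borelAdelic F E c 3) : (quasiSplit F E c 3).Adelic)) * 1)) := by
        refine tsum_congr fun w => ?_
        simp only [hG]
        exact lintegral_congr fun k => by rw [conj_torus_mul_eq]
    _ = _ := key
    _ = ∑' k : GaloisRepresentations.principalIdeles F,
          Φ' (k • AdeleRing.ideleRelNorm F E (diagUnit (t : borelAdelic F E c 3).2 0)) := by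
        refine tsum_congr fun k => ?_
        rw [hΦ', hG]
        simp only
        exact lintegral_congr fun k => by rw [one_inv_mul_mul_one]

/-- **The norm profile is continuous**: `y ↦ ∫_K f(k⁻¹ (z₁ n(θ(y⁻¹))) k) dμK` is continuous on `𝕀_F` for continuous `f`
(jointly continuous integrand on the compact `K`; Mathlib `continuous_parametric_integral_of_continuous`).
[cite: Rogawski1990, §7.3 Prop. 7.3.2 (p. 96)] -/
theorem continuous_centreProfile (hc : c * c = 1) (hcδ : c δ = -δ) (hδ : δ ≠ 0) (z₁ : (quasiSplit F E c 3).arithmeticSubgroup)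
    {f : (quasiSplit F E c 3).Adelic → ℂ} (hf : Continuous f) :
    Continuous fun y : (AdeleRing (𝓞 F) F)ˣ => ∫ k, f ((k : (quasiSplit F E c 3).Adelic)⁻¹ *
      ((z₁ : (quasiSplit F E c 3).Adelic) *
        ((heisChart hc ((0 : AdeleRing (𝓞 E) E),
            traceZeroLine F E c hcδ hδ (((y⁻¹ : (AdeleRing (𝓞 F) F)ˣ)) : AdeleRing (𝓞 F) F)) :
          adelicUnipotent F E c 3) : (quasiSplit F E c 3).Adelic)) * (k : (quasiSplit F E c 3).Adelic)) ∂μK := by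
  haveI := compactSpace_KU (F := F) (E := E) (c := c)
  haveI : IsFiniteMeasure μK := CompactSpace.isFiniteMeasure
  haveI := secondCountableTopology_ideleGroup F
  haveI := locallyCompactSpace_ideleGroup F
  have hcont : Continuous (Function.uncurry fun (y : (AdeleRing (𝓞 F) F)ˣ)
      (k : ((standardMaximalCompactGL 3 E).comap (adelicVal F E c 3 ((StdForm.antidiagonal 3).over E)) :
        Subgroup (quasiSplit F E c 3).Adelic)) =>
      f ((k : (quasiSplit F E c 3).Adelic)⁻¹ *
        ((z₁ : (quasiSplit F E c 3).Adelic) *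
          ((heisChart hc ((0 : AdeleRing (𝓞 E) E),
              traceZeroLine F E c hcδ hδ (((y⁻¹ : (AdeleRing (𝓞 F) F)ˣ)) : AdeleRing (𝓞 F) F)) :
            adelicUnipotent F E c 3) : (quasiSplit F E c 3).Adelic)) * (k : (quasiSplit F E c 3).Adelic))) := by
    have hθ : Continuous fun y : (AdeleRing (𝓞 F) F)ˣ =>
        ((heisChart hc ((0 : AdeleRing (𝓞 E) E),
            traceZeroLine F E c hcδ hδ (((y⁻¹ : (AdeleRing (𝓞 F) F)ˣ)) : AdeleRing (𝓞 F) F)) :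
          adelicUnipotent F E c 3) : (quasiSplit F E c 3).Adelic) :=
      continuous_subtype_val.comp ((heisChart hc).continuous.comp (continuous_const.prodMk
        ((traceZeroLine F E c hcδ hδ).continuous.comp (Units.continuous_val.comp continuous_inv))))
    exact hf.comp ((((continuous_subtype_val.comp continuous_snd).inv).mul
      (continuous_const.mul (hθ.comp continuous_fst))).mul (continuous_subtype_val.comp continuous_snd))
  have h := continuous_parametric_integral_of_continuous (μ := μK) hcont isCompact_univ
  simp only [Measure.restrict_univ] at h
  exact h

/-- **The norm profile is Borel measurable** (from ★ `continuous_centreProfile`) — the measurability input of ★ (C-P)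
`exists_push_and_integral_tsum_comp_ideleRelNorm_diagUnitZero_eq`. [cite: Rogawski1990, §7.3 Prop. 7.3.2 (p. 96)] -/
theorem measurable_centreProfile [MeasurableSpace (AdeleRing (𝓞 F) F)ˣ] [BorelSpace (AdeleRing (𝓞 F) F)ˣ]
    (hc : c * c = 1) (hcδ : c δ = -δ) (hδ : δ ≠ 0) (z₁ : (quasiSplit F E c 3).arithmeticSubgroup)
    {f : (quasiSplit F E c 3).Adelic → ℂ} (hf : Continuous f) :
    Measurable fun y : (AdeleRing (𝓞 F) F)ˣ => ∫ k, f ((k : (quasiSplit F E c 3).Adelic)⁻¹ *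
      ((z₁ : (quasiSplit F E c 3).Adelic) *
        ((heisChart hc ((0 : AdeleRing (𝓞 E) E),
            traceZeroLine F E c hcδ hδ (((y⁻¹ : (AdeleRing (𝓞 F) F)ˣ)) : AdeleRing (𝓞 F) F)) :
          adelicUnipotent F E c 3) : (quasiSplit F E c 3).Adelic)) * (k : (quasiSplit F E c 3).Adelic)) ∂μK :=
  (continuous_centreProfile μK hc hcδ hδ z₁ hf).measurable

end KAverage

end UnitaryGroup

end Literature.NumberTheory.Automorphic

end
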